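import Summits.Ventures.QEC.Census.FoldDefs2
import HarnessLib

/-!
# P3-PORT STEP 2 (E-fold tower, CARD-7): checker DEFINITIONS (cell `qec`, experiment CDX, seat qec-cdx-type-1; planner idea-1 g3/g4)

The nested, guarded, image-restricted fold tower for the EXTENDED code `E` of the depth-7 syndrome circuit of a BB code
(`E(3,3) →x E(6,3) →y E(6,6) →x E(12,6)`, five torus blocks = the five class-generator types of the K2 checker of record):
`k`-block twins of `Census.Fold.fiber` / `nodeCheck` with the small slot count `ns` EXPLICIT (`ns = 5·ls·ms` here; the Census
`Geo.ns = 2·ls·ms` is the only two-block constant in `fiber`), the windowed scan `scanW` (a partition of `scan` by the list index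
of the first chosen outside column — for the few fibres too large for one kernel `decide`), and the guarded node `nodeK`
(`Census.Fold.guardP` verbatim).  The linear-algebra core (`gaussPiv / pivOK / scan / solutions / mkWord / outsideOf / frhs`) is
`Census.FoldDefs` REUSED, not copied.  Pure definitions (idea-1's `etower/etlean/ETowerDefs.lean` prototype, CARD-7 §1, farm rc 0);
per-sector tables / continuations / units are separate data files; soundness (CARD-7 §5 S1–S7, PORT-SPEC) is typed in
`ETower*.lean` lemma files.  No `native_decide`; nothing here asserts a value of `d_circ`.
-/

set_option maxRecDepth 100000


namespace Summit.Ventures.QEC.CircuitDistance.ETower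

open Summit.Ventures.QEC.Census Summit.Ventures.QEC.Census.Fold

/-- FIBRE ENUMERATOR over a `k`-block torus code (`ns` = small slot count): all big words of weight `≤ W` with column syndrome
`0` folding exactly onto the small word with support list `P`; reduction-pruned subset scan for every budget `s ≥ 1`. -/
def fiberK (G : Geo) (ns : ℕ) (M Mp : ℕ → ℕ) (W : ℕ) (P : List ℕ) : Option (List (List ℕ)) :=
  let MP := P.map M
  let Pv := gaussPiv MP
  let s := (W - P.length) / 2
  let h := frhs Mp P
  let Ob := outsideOf ns P
  if 1 ≤ s then
    if pivOK MP Pv then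
      some ((scan Pv MP (Ob.map fun o => (o, M o, Pv.red (M o))) s h (Pv.red h) []).map fun ex => mkWord G P ex.1 ex.2)
    else none
  else
    if pivOKcore MP Pv then
      some ((scan Pv MP (Ob.map fun o => (o, M o, 0)) s h 0 []).map fun ex => mkWord G P ex.1 ex.2)
    else none

/-- WINDOWED SCAN: as `scan`, but the FIRST chosen outside column must have list index in `[lo, hi)` (index counter `i`);
the empty subset belongs to the window with `lo = 0`.  The windows of a partition of `[0, |O|)` together give `scan`. -/
def scanW (Pv : Piv) (MP : List ℕ) : List (ℕ × ℕ × ℕ) → ℕ → ℕ → ℕ → ℕ → ℕ → ℕ → List (List ℕ × ℕ)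
  | [], _, v, rv, lo, _, _ => if lo == 0 then (if rv == 0 then (Pv.solutions MP v).map fun x => ([], x) else []) else []
  | _ :: _, 0, v, rv, lo, _, _ => if lo == 0 then (if rv == 0 then (Pv.solutions MP v).map fun x => ([], x) else []) else []
  | oc :: O, s' + 1, v, rv, lo, hi, i =>
    (if lo ≤ i && i < hi then scan Pv MP O s' (v ^^^ oc.2.1) (rv ^^^ oc.2.2) [oc.1] else []) ++
      scanW Pv MP O (s' + 1) v rv lo hi (i + 1)

/-- windowed fibre enumerator (budget `s ≥ 1` assumed). -/
def fiberKW (G : Geo) (ns : ℕ) (M Mp : ℕ → ℕ) (W : ℕ) (P : List ℕ) (lo hi : ℕ) : Option (List (List ℕ)) :=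
  let MP := P.map M
  let Pv := gaussPiv MP
  let s := (W - P.length) / 2
  let h := frhs Mp P
  let Ob := outsideOf ns P
  if pivOK MP Pv then
    some ((scanW Pv MP (Ob.map fun o => (o, M o, Pv.red (M o))) s h (Pv.red h) lo hi 0).map fun ex => mkWord G P ex.1 ex.2)
  else none

/-- WINDOWED NODE (no guard: used for the special low-weight words whose whole fibre is certified window by window); the
support list is first normalised to increasing order (`bitsOf ns 0 (maskOf S)`, as in `Census.Fold.nodeCheck`). -/
def nodeKW (G : Geo) (ns : ℕ) (M Mp : ℕ → ℕ) (W : ℕ) (k : List ℕ → Bool) (S : List ℕ) (lo hi : ℕ) : Bool :=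
  let P := bitsOf ns 0 (maskOf S)
  match fiberKW G ns M Mp W P lo hi with
  | none => false
  | some out => out.all k

/-- NODE: the support list `S` is normalised to increasing order `P = bitsOf ns 0 (maskOf S)` (as in `Census.Fold.nodeCheck`),
the fibre over `P` is enumerated (pivot structure verified) and every output passes the guarded continuation (`guardP`: of each
pair `u, g·u` only the word through the section point `emb P[0]` of the smallest slot is continued). -/
def nodeK (G : Geo) (ns : ℕ) (M Mp : ℕ → ℕ) (W : ℕ) (k : List ℕ → Bool) (S : List ℕ) : Bool :=
  let P := bitsOf ns 0 (maskOf S)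
  match fiberK G ns M Mp W P with
  | none => false
  | some out => out.all (guardP G P k)

end Summit.Ventures.QEC.CircuitDistance.ETower
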